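import Literature.NumberTheory.Automorphic.TwistedQuotientIndFunDirectedInjective
import Literature.Algebra.Homology.GroupCohomologyFiniteType
import HarnessLib

/-!
# Cohomology of a directed union of lattices from the finite-type property of the stabilisers

Topic `NumberTheory/Automorphic`; namespace `Literature.NumberTheory.Automorphic.TwistedQuotient`.
One definition with body (the per-orbit directed system) and theorems; no named fact, no instance,
no `sorry`.

Variants of `exists_map_indFunMap_eq_of_directed` (`TwistedQuotientIndFunShapiroNatural`) and
`exists_map_indFunMap_eq_zero_of_directed` (`TwistedQuotientIndFunDirectedInjective`) in which the
hypothesis "each stabiliser `Γ_x` has a projective resolution of finite type (`FP_∞`)" is replaced by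
the weaker, purely cohomological `IsCohFiniteTypeUpTo A Γ_x m` of
`Literature/Algebra/Homology/GroupCohomologyFiniteType` — `H^q(Γ_x, -)` commutes with directed
unions UP TO THE MULTIPLIER `m` — which is what survives the passage to commensurable groups and
what an equivariant good cover provides (`GroupCohomologyGoodCoverFiniteType`).  Conclusions, for
`N = ⋃ N_i` a directed union of `L`-stable lattices and finitely many `Γ`-orbits on `𝒢 ⧸ L`:

* `exists_map_indFunMap_eq_of_cohFiniteType` — every `m • z`, `z ∈ H^q(Γ, indFun σ_N)`, is the
  image of a class of some `H^q(Γ, indFun σ_{N_i})`;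
* `exists_map_indFunMap_eq_zero_of_cohFiniteType` — if `y ∈ H^q(Γ, indFun σ_{N_i})` dies in
  `H^q(Γ, indFun σ_N)` then `m • y` dies in some `H^q(Γ, indFun σ_{N_j})`.

Proofs: orbitwise (`indToOrbitCohomologyNat_pi_bijective`, naturality
`indToOrbitCohomologyNat_map_indFunMap`) exactly as in the `FP_∞` versions.
[Scholze2015, §V.4, proof of Thm. V.4.1] uses these with `N_i = p^{-i} M`.

## References

* K. S. Brown, *Cohomology of Groups*, GTM 87 (1982), III (6.2), VIII (4.6), (4.8).
  [Brown1982CohomologyGroups]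
* P. Scholze, Ann. of Math. 182 (2015), §V.4, proof of Thm. V.4.1. [Scholze2015]
-/

noncomputable section

open CategoryTheory
open scoped Classical
open Literature.Algebra.Homology

universe u

namespace Literature.NumberTheory.Automorphic

namespace TwistedQuotient

variable {A : Type u} [CommRing A] {Γ 𝒢 : Type u} [Group Γ] [Group 𝒢] (ι : Γ →* 𝒢)
  (L : Subgroup 𝒢) {N : Type u} [AddCommGroup N] [Module A N] (σ : Representation A L N)

variable {ι' : Type u} [Preorder ι'] [IsDirected ι' (· ≤ ·)] [Nonempty ι']
  {Nst : ι' → Type u} [∀ i, AddCommGroup (Nst i)] [∀ i, Module A (Nst i)]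
  (σst : ∀ i, Representation A L (Nst i))
  (φ : ∀ i, (σst i).IntertwiningMap σ) (hinj : ∀ i, Function.Injective (φ i))
  (t : ∀ ⦃i j⦄, i ≤ j → (σst i).IntertwiningMap (σst j))
  (ht : ∀ ⦃i j⦄ (h : i ≤ j) (v : Nst i), φ j (t h v) = φ i v)
  (hcovN : ∀ v : N, ∃ i, ∃ w : Nst i, φ i w = v)

/-- **The directed system of the stabiliser representations at an orbit** `Γ_{g₀L}`:
`N_{i, g₀} ↪ N_{g₀}`. [cite: Brown1982CohomologyGroups, VIII (4.6)] -/
@[reducible]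
def indStabSystem (g₀ : 𝒢) : DirectedSubrepSystem A (orbitStabilizer ι L (g₀ : 𝒢 ⧸ L)) where
  ι := ι'
  A i := indStabilizerRep ι L (σst i) g₀
  B := indStabilizerRep ι L σ g₀
  φ i := indStabMap ι L (σst i) σ g₀ (φ i)
  injective i := indStabMap_injective ι L (σst i) σ g₀ (φ i) (hinj i)
  t _ _ h := indStabMap ι L (σst _) (σst _) g₀ (t h)
  t_comp _ _ h := Rep.hom_ext (Representation.IntertwiningMap.ext (LinearMap.ext fun v => ht h v))
  exhaust v := hcovN v

include hinj ht hcovN in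
/-- **Cohomology of a directed union of lattices, surjectivity up to `m`.**  If `N = ⋃_i N_i`
(directed, `L`-stable, `φ_i : N_i ↪ N`), the `Γ`-orbits on `𝒢 ⧸ L` admit a finite complete system
`s` of representatives, and `H^q(Γ_x, -)` is of finite type up to `m` for each `x ∈ s`
(`IsCohFiniteTypeUpTo`), then for every `z ∈ H^q(Γ, indFun σ_N)` the multiple `m • z` is the
image of a class of `H^q(Γ, indFun σ_{N_i})` for some `i`.
[cite: Scholze2015, §V.4 (proof of Thm. V.4.1)] [cite: Brown1982CohomologyGroups, VIII (4.6)] -/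
theorem exists_map_indFunMap_eq_of_cohFiniteType (s : Finset 𝒢)
    (hdisj : ∀ x ∈ s, ∀ y ∈ s, (∃ γ : Γ, ι γ • (x : 𝒢 ⧸ L) = (y : 𝒢 ⧸ L)) → x = y)
    (hcov : ∀ g : 𝒢, ∃ x ∈ s, ∃ γ : Γ, ι γ • (x : 𝒢 ⧸ L) = (g : 𝒢 ⧸ L)) {m : ℕ}
    (hFT : ∀ x ∈ s, IsCohFiniteTypeUpTo A (orbitStabilizer ι L (x : 𝒢 ⧸ L)) m)
    (q : ℕ) (z : groupCohomology (indFun ι L σ) q) :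
    ∃ i, ∃ y : groupCohomology (indFun ι L (σst i)) q,
      groupCohomology.map (MonoidHom.id Γ) (indFunMap ι L (σst i) σ (φ i)) q y = m • z := by
  classical
  let P : ProjectiveResolution (Rep.trivial A Γ A) := Rep.barResolution A Γ
  -- per orbit: index `i x` and preimage `y x` of `m •` the `x`-component of `z`
  have hx : ∀ x ∈ s, ∃ i, ∃ y : groupCohomology (indStabilizerRep ι L (σst i) x) q,
      groupCohomology.map (MonoidHom.id _) (indStabMap ι L (σst i) σ x (φ i)) q y =
        m • indToOrbitCohomologyNat ι L σ x P q z := fun x hx =>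
    (hFT x hx).exists_map_eq (indStabSystem ι L σ σst φ hinj t ht hcovN x) q _
  choose i y hy using hx
  -- a common index `M ≥ i x`
  have hiM' : ∃ M, ∀ (x : 𝒢) (hx : x ∈ s), i x hx ≤ M := by
    obtain ⟨M, hM⟩ := Finset.exists_le (s.attach.image fun x : {x // x ∈ s} => i x.1 x.2)
    exact ⟨M, fun x hx => hM _ (Finset.mem_image.2 ⟨⟨x, hx⟩, Finset.mem_attach _ _, rfl⟩)⟩
  obtain ⟨M, hiM⟩ := hiM'
  -- transport the preimages to the stage `M`
  let w : ∀ x : s, groupCohomology (indStabilizerRep ι L (σst M) x.1) q := fun x =>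
    groupCohomology.map (MonoidHom.id _)
      (indStabMap ι L (σst (i x.1 x.2)) (σst M) x.1 (t (hiM x.1 x.2))) q (y x.1 x.2)
  have hw : ∀ x : s, groupCohomology.map (MonoidHom.id _) (indStabMap ι L (σst M) σ x.1 (φ M)) q (w x) =
      m • indToOrbitCohomologyNat ι L σ x.1 P q z := fun x => by
    change (groupCohomology.map (MonoidHom.id _)
        (indStabMap ι L (σst (i x.1 x.2)) (σst M) x.1 (t (hiM x.1 x.2))) q ≫
      groupCohomology.map (MonoidHom.id _) (indStabMap ι L (σst M) σ x.1 (φ M)) q) (y x.1 x.2) = _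
    rw [← groupCohomology.map_id_comp]
    have hcomp : indStabMap ι L (σst (i x.1 x.2)) (σst M) x.1 (t (hiM x.1 x.2)) ≫
        indStabMap ι L (σst M) σ x.1 (φ M) = indStabMap ι L (σst (i x.1 x.2)) σ x.1 (φ (i x.1 x.2)) :=
      Rep.hom_ext (Representation.IntertwiningMap.ext (LinearMap.ext fun v => ht (hiM x.1 x.2) v))
    rw [hcomp]
    exact hy x.1 x.2
  -- glue at the stage `M` and compare components in `σ`
  obtain ⟨Y, hY⟩ := (indToOrbitCohomologyNat_pi_bijective ι L (σst M) P s hdisj hcov q).2 w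
  refine ⟨M, Y, (indToOrbitCohomologyNat_pi_bijective ι L σ P s hdisj hcov q).1 (funext fun x => ?_)⟩
  simp only
  rw [indToOrbitCohomologyNat_map_indFunMap, map_nsmul, ← hw x]
  congr 1
  exact congr_fun hY x

include hinj ht hcovN in
/-- **Cohomology of a directed union of lattices, injectivity up to `m`.**  Under the same
hypotheses, a class `y ∈ H^q(Γ, indFun σ_{N_i})` mapping to `0` in `H^q(Γ, indFun σ_N)` has
`m • y` mapping to `0` in `H^q(Γ, indFun σ_{N_j})` for some `j ≥ i`.
[cite: Scholze2015, §V.4 (proof of Thm. V.4.1)] [cite: Brown1982CohomologyGroups, VIII (4.6)] -/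
theorem exists_map_indFunMap_eq_zero_of_cohFiniteType (s : Finset 𝒢)
    (hdisj : ∀ x ∈ s, ∀ y ∈ s, (∃ γ : Γ, ι γ • (x : 𝒢 ⧸ L) = (y : 𝒢 ⧸ L)) → x = y)
    (hcov : ∀ g : 𝒢, ∃ x ∈ s, ∃ γ : Γ, ι γ • (x : 𝒢 ⧸ L) = (g : 𝒢 ⧸ L)) {m : ℕ}
    (hFT : ∀ x ∈ s, IsCohFiniteTypeUpTo A (orbitStabilizer ι L (x : 𝒢 ⧸ L)) m)
    (q : ℕ) (i : ι') (y : groupCohomology (indFun ι L (σst i)) q)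
    (hy : groupCohomology.map (MonoidHom.id Γ) (indFunMap ι L (σst i) σ (φ i)) q y = 0) :
    ∃ j, ∃ h : i ≤ j,
      groupCohomology.map (MonoidHom.id Γ) (indFunMap ι L (σst i) (σst j) (t h)) q (m • y) = 0 := by
  classical
  let P : ProjectiveResolution (Rep.trivial A Γ A) := Rep.barResolution A Γ
  -- per orbit: `m •` the `x`-component of `y` dies at some stage `j x ≥ i`
  have hx : ∀ x ∈ s, ∃ j, ∃ h : i ≤ j, groupCohomology.map (MonoidHom.id _)
      (indStabMap ι L (σst i) (σst j) x (t h)) q (m • indToOrbitCohomologyNat ι L (σst i) x P q y) = 0 := by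
    intro x hx
    refine (hFT x hx).exists_map_eq_zero (indStabSystem ι L σ σst φ hinj t ht hcovN x) q i _ ?_
    change groupCohomology.map (MonoidHom.id _) (indStabMap ι L (σst i) σ x (φ i)) q
      (indToOrbitCohomologyNat ι L (σst i) x P q y) = 0
    rw [← indToOrbitCohomologyNat_map_indFunMap, hy, map_zero]
  choose j hij hj using hx
  -- a common stage `J`
  have hJ' : ∃ J, i ≤ J ∧ ∀ (x : 𝒢) (hx : x ∈ s), j x hx ≤ J := by
    obtain ⟨J, hJ⟩ := Finset.exists_le (insert i (s.attach.image fun x : {x // x ∈ s} => j x.1 x.2))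
    exact ⟨J, hJ _ (Finset.mem_insert_self _ _), fun x hx => hJ _ (Finset.mem_insert_of_mem
      (Finset.mem_image.2 ⟨⟨x, hx⟩, Finset.mem_attach _ _, rfl⟩))⟩
  obtain ⟨J, hiJ, hjJ⟩ := hJ'
  refine ⟨J, hiJ, ?_⟩
  -- all components of `t_{iJ *} (m • y)` vanish
  have hcompx : ∀ (x : 𝒢) (hx : x ∈ s), groupCohomology.map (MonoidHom.id _)
      (indStabMap ι L (σst i) (σst J) x (t hiJ)) q
        (indToOrbitCohomologyNat ι L (σst i) x P q (m • y)) = 0 := by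
    intro x hx
    have hfac : indStabMap ι L (σst i) (σst J) x (t hiJ) =
        indStabMap ι L (σst i) (σst (j x hx)) x (t (hij x hx)) ≫
          indStabMap ι L (σst (j x hx)) (σst J) x (t (hjJ x hx)) :=
      Rep.hom_ext (Representation.IntertwiningMap.ext (LinearMap.ext fun v =>
        (transition_comp L σ σst φ hinj t ht (hij x hx) (hjJ x hx) v).symm))
    rw [hfac, groupCohomology.map_id_comp, ModuleCat.comp_apply, map_nsmul, hj x hx, map_zero]
  apply (indToOrbitCohomologyNat_pi_bijective ι L (σst J) P s hdisj hcov q).1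
  funext x
  simp only
  rw [indToOrbitCohomologyNat_map_indFunMap, hcompx x.1 x.2, map_zero]

end TwistedQuotient

end Literature.NumberTheory.Automorphic
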